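import Mathlib
import Summits.Ventures.PercRepro2.HCov
import Summits.Ventures.PercRepro2.RECMReduction
import Summits.Ventures.PercRepro2.GcTransportMarks
import Summits.Ventures.PercRepro2.GcSkelReductionC
import Summits.Ventures.PercRepro2.GcBlockPush
import Summits.Ventures.PercRepro2.GcBlockConn

/-!
# The exact block reduction of the covariance form (blind cell PercRepro2, typer-1 g54)

A **mark-free two-terminal block** — a vertex set `W` carrying no mark, with terminals
`u, v ∉ W`, every edge touching `W` having both ends in `W ∪ {u, v}` (`Block.IsBlock`) — is
invisible to the five marks except through the event «`u ↔ v` inside the block». So the whole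
block is **one edge** `{u, v}` of weight `P_p(u ↔ v inside the block)`:

* **`Gc_block`** — `Gc p ends = Gc p' ends'` with `ends' = blockEnds ends S e₀ u v` (`e₀ ∈ S` the
  surviving edge, re-wired to `{u, v}`; the other edges of `S = touches ends W` loops) and
  `p' = blockWeights S e₀ (P_p(u ↔ v inside S)) p`, by `Gc_transport_marks` with the block map,
  `prob_block_pushforward` (`GcBlockPush.lean`) and `conn_block_iff` (`GcBlockConn.lean`);
* `isProbVec_blockWeights` (the collapsed weights are admissible), `nonLoopCard_block_lt_of_two`
  / `nonLoopCard_block_lt_of_eq` (the collapse lowers the number of non-loop edges when two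
  non-loop edges touch `W`, or when the terminals coincide and one does);
* **`HasBlock`** — the instances the collapse shrinks; **`HCov_of_hasBlock`**: on such an instance
  (HCOV) follows from (HCOV) on an instance with fewer non-loop edges — a REDUCTION step for the
  strong induction of the weighted residual (`GcSkelReductionT.lean`).

It contains the unmarked-leaf rule (`W = {y}`, `u = v`), the series rule (`W = {y}` of non-loop
degree two) and the pruning of a mark-free side at a cut vertex (`u = v` the cut vertex) as
special cases, and is new beyond them: a mark-free side of a separating PAIR `{u, v}` collapses.
-/

namespace Summit.Ventures.PercRepro2

open CovForm RECM SepPair WRed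

namespace Block

/-! ## The identity -/

section Identity

variable {V : Type*} {E : Type*} [Fintype E] [DecidableEq E] [DecidableEq V] {R : Type*}
  [Field R] [LinearOrder R]

omit [DecidableEq V] [LinearOrder R] in
/-- **The exact block reduction**: for a two-terminal block `W` containing none of the five marks,
`Gc` of the collapsed instance equals `Gc` of the original one. -/
theorem Gc_block (p : E → R) {ends : E → Sym2 V} {W : Set V} {u v : V} (hB : IsBlock ends W u v)
    {S : Set E} [DecidablePred (· ∈ S)] (hS : ∀ e, e ∈ S ↔ e ∈ touches ends W) {e₀ : E}
    (he₀ : e₀ ∈ S) (o a₁ a₂ a₃ b : V) (ho : o ∉ W) (h1 : a₁ ∉ W) (h2 : a₂ ∉ W) (h3 : a₃ ∉ W)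
    (hb : b ∉ W) :
    Gc (blockWeights S e₀ (prob p {ω | blockObs ends S u v ω = true}) p)
        (blockEnds ends S e₀ u v) o a₁ a₂ a₃ b =
      Gc p ends o a₁ a₂ a₃ b := by
  have hmem : ∀ x ∈ ({o, a₁, a₂, a₃, b} : Set V), x ∉ W := by
    intro x hx
    simp only [Set.mem_insert_iff, Set.mem_singleton_iff] at hx
    rcases hx with rfl | rfl | rfl | rfl | rfl <;> assumption
  exact Gc_transport_marks (Ψ := blockMap S e₀ (blockObs ends S u v)) (φ := id)
    (fun A => prob_block_pushforward p S he₀ (dependsOn_blockObs ends S u v) A) o a₁ a₂ a₃ b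
    (fun ω x hx z hz => conn_block_iff hB hS he₀ ω (hmem x hx) (hmem z hz))

end Identity

/-! ## Admissibility and the drop in the number of non-loop edges -/

section Card

variable {V : Type*} {E : Type*} [Fintype E] [DecidableEq E] [DecidableEq V]

omit [Fintype E] [DecidableEq V] in
/-- The collapsed weights are admissible when the new weight is. -/
lemma isProbVec_blockWeights {R : Type*} [CommRing R] [PartialOrder R] [IsOrderedRing R]
    {p : E → R} (hp : IsProbVec p) (S : Set E) [DecidablePred (· ∈ S)] (e₀ : E) {q₀ : R}
    (h0 : 0 ≤ q₀) (h1 : q₀ ≤ 1) : IsProbVec (blockWeights S e₀ q₀ p) := by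
  refine ⟨fun e => ?_, fun e => ?_⟩
  · by_cases he : e = e₀
    · subst he; simp [blockWeights, h0]
    · by_cases heS : e ∈ S
      · simp [blockWeights, he, heS]
      · simp [blockWeights, he, heS, hp.nonneg e]
  · by_cases he : e = e₀
    · subst he; simp [blockWeights, h1]
    · by_cases heS : e ∈ S
      · simp [blockWeights, he, heS]
      · simp [blockWeights, he, heS, hp.le_one e]

omit [Fintype E] [DecidableEq V] in
/-- A non-loop edge of the collapsed incidence map is `e₀` or an edge outside `S`, and it is a
non-loop edge of `ends` when `ends e₀` is one. -/
lemma not_isDiag_of_blockEnds {ends : E → Sym2 V} {S : Set E} [DecidablePred (· ∈ S)] {e₀ : E}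
    (he₀ : e₀ ∈ S) (hne₀ : ¬ (ends e₀).IsDiag) {u v : V} {e : E}
    (h : ¬ (blockEnds ends S e₀ u v e).IsDiag) : ¬ (ends e).IsDiag ∧ (e = e₀ ∨ e ∉ S) := by
  by_cases he : e = e₀
  · subst he; exact ⟨hne₀, Or.inl rfl⟩
  · by_cases heS : e ∈ S
    · rw [blockEnds_apply_of_mem he heS, Sym2.mk_isDiag_iff] at h
      exact absurd rfl h
    · rw [blockEnds_apply_of_notMem he₀ heS] at h
      exact ⟨h, Or.inr heS⟩

/-- **The collapse lowers the number of non-loop edges** when two distinct non-loop edges touch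
the block. -/
lemma nonLoopCard_block_lt_of_two {ends : E → Sym2 V} {S : Set E} [DecidablePred (· ∈ S)]
    {e₀ e₁ : E} (he₀ : e₀ ∈ S) (he₁ : e₁ ∈ S) (hne : e₀ ≠ e₁) (hd₀ : ¬ (ends e₀).IsDiag)
    (hd₁ : ¬ (ends e₁).IsDiag) (u v : V) :
    nonLoopCard (blockEnds ends S e₀ u v) < nonLoopCard ends := by
  refine nonLoopCard_lt_of_inj id (fun e he => (not_isDiag_of_blockEnds he₀ hd₀ he).1)
    (fun _ _ _ _ h => h) hd₁ (fun e he h => ?_)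
  have h' : e = e₁ := h
  rcases (not_isDiag_of_blockEnds he₀ hd₀ he).2 with rfl | heS
  · exact hne h'
  · exact heS (h' ▸ he₁)

/-- **The collapse lowers the number of non-loop edges** when the terminals coincide and a
non-loop edge touches the block (the surviving edge becomes a loop). -/
lemma nonLoopCard_block_lt_of_eq {ends : E → Sym2 V} {S : Set E} [DecidablePred (· ∈ S)]
    {e₀ : E} (he₀ : e₀ ∈ S) (hd₀ : ¬ (ends e₀).IsDiag) (u : V) :
    nonLoopCard (blockEnds ends S e₀ u u) < nonLoopCard ends := by
  have hloop : ∀ e, ¬ (blockEnds ends S e₀ u u e).IsDiag → ¬ (ends e).IsDiag ∧ e ∉ S := by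
    intro e he
    by_cases h : e = e₀
    · subst h
      rw [blockEnds_apply_self, Sym2.mk_isDiag_iff] at he
      exact absurd rfl he
    · by_cases heS : e ∈ S
      · rw [blockEnds_apply_of_mem h heS, Sym2.mk_isDiag_iff] at he
        exact absurd rfl he
      · rw [blockEnds_apply_of_notMem he₀ heS] at he
        exact ⟨he, heS⟩
  exact nonLoopCard_lt_of_inj id (fun e he => (hloop e he).1) (fun _ _ _ _ h => h) hd₀
    (fun e he h => (hloop e he).2 ((show e = e₀ from h) ▸ he₀))

end Card

/-! ## The reduction step -/

section Step

variable {V : Type*} {E : Type*} [Fintype E] [DecidableEq E] [DecidableEq V]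

/-- **A block the collapse shrinks**: a two-terminal block carrying none of the five marks, with
two distinct non-loop edges touching it, or with coinciding terminals and one non-loop edge
touching it. -/
def HasBlock (ends : E → Sym2 V) (o a₁ a₂ a₃ b : V) : Prop :=
  ∃ (W : Set V) (u v : V), IsBlock ends W u v ∧ (∀ y ∈ W, Unmarked o a₁ a₂ a₃ b y) ∧
    ((∃ e₀ e₁, e₀ ≠ e₁ ∧ e₀ ∈ touches ends W ∧ e₁ ∈ touches ends W ∧ ¬ (ends e₀).IsDiag ∧
        ¬ (ends e₁).IsDiag) ∨
      (u = v ∧ ∃ e₀, e₀ ∈ touches ends W ∧ ¬ (ends e₀).IsDiag))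

variable {R : Type*} [Field R] [LinearOrder R] [IsStrictOrderedRing R]

omit [DecidableEq V] [IsStrictOrderedRing R] in
/-- **(HCOV) from the collapsed instance**: for a two-terminal block free of the marks, (HCOV)
on the collapse gives (HCOV) on the original instance. -/
theorem HCov_of_block {p : E → R} {ends : E → Sym2 V} {W : Set V} {u v : V}
    (hB : IsBlock ends W u v) {S : Set E} [DecidablePred (· ∈ S)]
    (hS : ∀ e, e ∈ S ↔ e ∈ touches ends W) {e₀ : E} (he₀ : e₀ ∈ S) {o a₁ a₂ a₃ b : V}
    (ho : o ∉ W) (h1 : a₁ ∉ W) (h2 : a₂ ∉ W) (h3 : a₃ ∉ W) (hb : b ∉ W)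
    (h : HCov (blockWeights S e₀ (prob p {ω | blockObs ends S u v ω = true}) p)
      (blockEnds ends S e₀ u v) o a₁ a₂ a₃ b) :
    HCov p ends o a₁ a₂ a₃ b := by
  unfold HCov at h ⊢
  rw [← Gc_block p hB hS he₀ o a₁ a₂ a₃ b ho h1 h2 h3 hb]
  exact h

/-- **The block reduction step**: on an instance with a block the collapse shrinks, (HCOV)
follows from (HCOV) on every admissible instance with fewer non-loop edges. -/
theorem HCov_of_hasBlock {p : E → R} (hp : IsProbVec p) {ends : E → Sym2 V} {o a₁ a₂ a₃ b : V}
    (ih : ∀ ends' : E → Sym2 V, nonLoopCard ends' < nonLoopCard ends → ∀ p' : E → R,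
      IsProbVec p' → HCov p' ends' o a₁ a₂ a₃ b)
    (h : HasBlock ends o a₁ a₂ a₃ b) : HCov p ends o a₁ a₂ a₃ b := by
  classical
  obtain ⟨W, u, v, hB, hW, hcase⟩ := h
  have hmark : ∀ x, ¬ Unmarked o a₁ a₂ a₃ b x → x ∉ W := fun x hx hxW => hx (hW x hxW)
  have ho : o ∉ W := hmark o fun h => h.1 rfl
  have h1 : a₁ ∉ W := hmark a₁ fun h => h.2.1 rfl
  have h2 : a₂ ∉ W := hmark a₂ fun h => h.2.2.1 rfl
  have h3 : a₃ ∉ W := hmark a₃ fun h => h.2.2.2.1 rfl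
  have hb : b ∉ W := hmark b fun h => h.2.2.2.2 rfl
  have hq0 : 0 ≤ prob p {ω | blockObs ends (touches ends W) u v ω = true} := prob_nonneg hp _
  have hq1 : prob p {ω | blockObs ends (touches ends W) u v ω = true} ≤ 1 := prob_le_one hp _
  rcases hcase with ⟨e₀, e₁, hne, he₀, he₁, hd₀, hd₁⟩ | ⟨rfl, e₀, he₀, hd₀⟩
  · exact HCov_of_block hB (fun _ => Iff.rfl) he₀ ho h1 h2 h3 hb
      (ih _ (nonLoopCard_block_lt_of_two he₀ he₁ hne hd₀ hd₁ u v) _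
        (isProbVec_blockWeights hp _ e₀ hq0 hq1))
  · exact HCov_of_block hB (fun _ => Iff.rfl) he₀ ho h1 h2 h3 hb
      (ih _ (nonLoopCard_block_lt_of_eq he₀ hd₀ u) _ (isProbVec_blockWeights hp _ e₀ hq0 hq1))

end Step

end Block

end Summit.Ventures.PercRepro2
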